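import Summits.ABC.IUTFork.Thm311LogvolInvariance
import Summits.ABC.IUTFork.Thm311RealLattice
import HarnessLib

/-!
# [IUTchIII] Cor. 3.12, TEAM B row B-2 (real half): (Ind1)/(Ind2) preserve admissibility and log-volume —
# the lattice-realisation criterion, and its witnesses at the Dupuy–Hilado shells

Record-only file (D-0012) of the abc-iut cell (Cor. 3.12 strategy TEAM B «estimate / log-Kummer» of HUMAN
RULING D-0067 (3), row B-2 of `HOME/plan/C312-TEAMS.md`, seat abc-iut-c312-12 = B2; the closure-induction
half of B-2 is abc-iut-c312-11's `Cor312IndVolumeInvariance` (staged), whose generator-level hypotheses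
`GeneratorsPreserveAdm`/`GeneratorsPreserveLogvol` are DEFINITIONALLY the two conclusions proved here);
TAKES NO SIDE. Step (x) of the proof of Cor. 3.12 (kurims `paper:url-4b091feeb646`, p. 180 l. 43 –
p. 181 l. 32) asserts the procession-normalized log-volumes are "invariant with respect to the
indeterminacies (Ind1), (Ind2)"; Dupuy–Hilado (arXiv:2004.13228) §4.7 ("fixes the lattice
`⊕ I_{(v̲_0,…,v̲_j)}`") and §4.9 ("`ℤ_p`-lattice isomorphisms of `I_{v̲}` … the measure of sets are
preserved under these maps") read the indeterminacies as LATTICE AUTOMORPHISMS. This file: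

* `MRData.ind_adm_iff_and_logvolInvariant_of_latticeRealisations` — **the single-Haar-container
  criterion** (abc-iut-c312-d1's reading, `Thm311LogvolInvariance`): if the data (a)'s log-volume and
  admissibility are read through maps `e` into topologised containers with normalised Haar measures
  (`D.logvol j v_ℚ A = μ^log_Λ(e(A))/d`, `D.Adm j v_ℚ A ↔ 0 < μ_Λ(e(A)) < ∞`), and every (Ind1)- and (Ind2)-family is realised on each container by an additive homeomorphism mapping SOME integral
  structure onto itself ("fixes the lattice" — not necessarily the normalising one), then BOTH
  generator-level invariances hold: `∀ Ψ ∈ Ind1Family ∪ Ind2Family`, admissibility is preserved in both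
  directions AND log-volumes are unchanged (= `MRData.LogvolInvariant`). These two conclusions are, once
  c312-11's B-2 file lands, literally `Cor312Vol.GeneratorsPreserveAdm P` and
  `Cor312Vol.GeneratorsPreserveLogvol P` at `D = S.D P.n` — the inputs of its closure induction
  (`adm_image_iff_of_mem_indGroup`, `logvol_image_eq_of_mem_indGroup`, `bridgeHyps_of_generators`).
  New content over c312-d1: the admissibility half for lattice (not yet volume-preserving) realisations,
  by `IntegralStructure.haar_image_of_preserves`; the volume half specialises c312-d1's
  `logvolInvariant_of_latticeAutomorphisms`.
* `MRData.logvolInvariant_union` — the `∪`-form wrapper of `LogvolInvariant` (the exact binder shape of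
  the closure induction).
* **Witnesses at the Dupuy–Hilado shells** (`Thm311RealDH.ismDH`, where (Ind2) at a finite place is BY
  DEFINITION a bicontinuous `ℚ`-linear automorphism `φ` of `K_v` with `φ(I_v) = I_v`):
  `homeoOfLinearEquiv` (a bicontinuous linear automorphism as an `≃ₜ+`), `Real.ismDHHomeoInr` (the
  realisation of an (Ind2) generator at a finite place), `Real.ismDHHomeoInr_image_shell` /
  `Real.ismDH_image_closure_shell` (it maps the shell, and the shell LATTICE `⟨I_v⟩ = `
  `AddSubgroup.closure (shell)`, onto themselves — abc-iut-c312-5's `image_shellSubgroup_of_image_shell`),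
  `Real.haar_image_of_mem_ismDH` (hence it preserves EVERY normalised Haar measure of the carrier —
  c312-d1's `haar_image_of_preserves` with `Λ₀` = the shell lattice: the DH §4.9 footnote at the real
  carrier), and `Real.continuous_of_mem_ismDH_inl` (at an archimedean place the (Ind2) generators
  `{1, −1}` are bicontinuous — `IntegralStructure.haar_neg` covers their measure preservation).

SEAM (named, not crossed here): realising the generators on the TENSOR-PACKET containers themselves
(`⨂[ℚ_p]`-congruence of the per-place realisations + the S1 comparison's (Ind1)/(Ind2)-naturality) is
abc-iut-c312-3's W2-G (`PrimewisePackets`/`TensorPacketShell`) and abc-iut-c312-5's A-0 summandwise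
container; this file supplies the per-place realisations and the container-level criterion they feed.
Sources read on the page: [IUTchIII] pp. 153–156 (Thm. 3.11 (i), (ii)), pp. 180–181 (Step (x));
Dupuy–Hilado §4 intro, §4.7, §4.9. [claim: Mochizuki2012, status: disputed] [cite: DupuyHilado2025, §4.9]
Deliberately NOT here: the closure induction (c312-11, B-2 first half), the (Ind3) bound (row B-3), the
tensor-packet containers (c312-3 W2-G / c312-5 A-0), any judgement on Cor. 3.12.
-/

noncomputable section

open MeasureTheory Set
open Literature.IUT.LogVolume

namespace Summit.ABC

namespace IUTFork

namespace Thm311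

variable {T : ThetaIndex} {L : LogShells T}

/-! ## 1. The single-Haar-container criterion, generator level -/

namespace MRData

variable (D : MRData L)
variable {W : T.Label → T.VQ → Type*} [∀ j vQ, AddCommGroup (W j vQ)]
  [∀ j vQ, TopologicalSpace (W j vQ)] [∀ j vQ, IsTopologicalAddGroup (W j vQ)]
  [∀ j vQ, MeasurableSpace (W j vQ)] [∀ j vQ, BorelSpace (W j vQ)]
  (Λ : ∀ j vQ, IntegralStructure (W j vQ)) (d : T.Label → T.VQ → ℕ)
  (e : ∀ (j : T.Label) (vQ : T.VQ), L.Packet j vQ → W j vQ)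

/-- The `∪`-form of `LogvolInvariant` — the exact binder shape consumed by the closure induction of
TEAM B's row B-2 (c312-11 `Cor312Vol.GeneratorsPreserveLogvol`). [folklore] -/
theorem logvolInvariant_union (h : D.LogvolInvariant) :
    ∀ Ψ ∈ L.Ind1Family ∪ L.Ind2Family, ∀ (j : T.Label) (vQ : T.VQ) (A : Set (L.Packet j vQ)),
      D.Adm j vQ A → D.logvol j vQ (Ψ j vQ '' A) = D.logvol j vQ A :=
  fun Ψ hΨ => h Ψ hΨ

/-- **The single-Haar-container criterion for BOTH generator-level invariances of Step (x)** (p. 180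
l. 47–49: the log-volumes are "invariant with respect to the indeterminacies (Ind1), (Ind2)"): with the
log-volume and admissibility of the data (a) read through `e` into containers with normalised Haar
measures, and every (Ind1)- or (Ind2)-family realised by an additive homeomorphism mapping SOME integral
structure onto itself (Dupuy–Hilado §4.7 "fixes the lattice", §4.9 "`ℤ_p`-lattice isomorphisms of
`I_{v̲}`"), every generator preserves admissibility (both directions) and log-volume. The two conclusions
are definitionally `GeneratorsPreserveAdm`/`GeneratorsPreserveLogvol` of c312-11's closure-induction file
at `D = S.D P.n`. [claim: Mochizuki2012, status: disputed] -/
theorem ind_adm_iff_and_logvolInvariant_of_latticeRealisations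
    (hlogvol : ∀ (j : T.Label) (vQ : T.VQ) (A : Set (L.Packet j vQ)),
      D.logvol j vQ A = (Λ j vQ).normalizedLogVolume (d j vQ) (e j vQ '' A))
    (hAdm : ∀ (j : T.Label) (vQ : T.VQ) (A : Set (L.Packet j vQ)),
      D.Adm j vQ A ↔ 0 < (Λ j vQ).haar (e j vQ '' A) ∧ (Λ j vQ).haar (e j vQ '' A) < ⊤)
    (hInd : ∀ Φ : L.PacketAut, (Φ ∈ L.Ind1Family ∨ Φ ∈ L.Ind2Family) → ∀ (j : T.Label) (vQ : T.VQ),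
      ∃ (ψ : W j vQ ≃ₜ+ W j vQ) (Λ₀ : IntegralStructure (W j vQ)),
        ψ '' (Λ₀ : Set (W j vQ)) = (Λ₀ : Set (W j vQ)) ∧ ∀ x, e j vQ (Φ j vQ x) = ψ (e j vQ x)) :
    (∀ Ψ ∈ L.Ind1Family ∪ L.Ind2Family, ∀ (j : T.Label) (vQ : T.VQ) (A : Set (L.Packet j vQ)),
        D.Adm j vQ A ↔ D.Adm j vQ (Ψ j vQ '' A)) ∧ D.LogvolInvariant := by
  have hInd' : ∀ Φ : L.PacketAut, (Φ ∈ L.Ind1Family ∨ Φ ∈ L.Ind2Family) →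
      ∀ (j : T.Label) (vQ : T.VQ),
      ∃ ψ : W j vQ ≃ₜ+ W j vQ, (∀ B : Set (W j vQ), (Λ j vQ).haar (ψ '' B) = (Λ j vQ).haar B) ∧
        ∀ x, e j vQ (Φ j vQ x) = ψ (e j vQ x) := by
    intro Φ hΦ j vQ
    obtain ⟨ψ, Λ₀, hΛ₀, hcomm⟩ := hInd Φ hΦ j vQ
    exact ⟨ψ, fun B => (Λ j vQ).haar_image_of_preserves ψ Λ₀ hΛ₀ B, hcomm⟩
  exact ⟨D.adm_iff_adm_image_of_volumePreserving Λ e hAdm hInd',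
    D.logvolInvariant_of_volumePreserving Λ d e hlogvol hInd'⟩

end MRData

/-! ## 2. Bicontinuous linear automorphisms as container realisations -/

/-- A bicontinuous `ℚ`-linear automorphism, packaged as an additive homeomorphism — the shape of the
Dupuy–Hilado (Ind2) generators (`Thm311RealDH.ismDH`: "bicontinuous `ℚ`-linear `φ` with
`φ '' I_v = I_v`"). [cite: DupuyHilado2025, §4.9] -/
def homeoOfLinearEquiv {M : Type*} [AddCommGroup M] [Module ℚ M] [TopologicalSpace M]
    (φ : M ≃ₗ[ℚ] M) (hc : Continuous φ) (hc' : Continuous φ.symm) : M ≃ₜ+ M where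
  toAddEquiv := φ.toAddEquiv
  continuous_toFun := hc
  continuous_invFun := hc'

/-- The realisation acts as `φ` does. [folklore] -/
@[simp] theorem coe_homeoOfLinearEquiv {M : Type*} [AddCommGroup M] [Module ℚ M] [TopologicalSpace M]
    (φ : M ≃ₗ[ℚ] M) (hc : Continuous φ) (hc' : Continuous φ.symm) :
    ⇑(homeoOfLinearEquiv φ hc hc') = ⇑φ := rfl

/-! ## 3. Witnesses at the Dupuy–Hilado shells -/

namespace Real

open NumberField IsDedekindDomain

variable {F : Type} [Field F] [NumberField F] (logv : PadicLogs F)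

/-- **The (Ind2) generators at an archimedean place are bicontinuous**: at `x = .inl w` the DH family is
`{1, −1}` ([IUTchIII] Thm. 3.11 (i) (Ind2) p. 154, Prop. 1.2 (vii) "automorphisms of order 2"), and both
the identity and the negation are continuous with continuous inverse (their measure preservation is
`IntegralStructure.haar_neg`). [cite: DupuyHilado2025, §4.9] -/
theorem continuous_of_mem_ismDH_inl {w : InfinitePlace F}
    {φ : Carrier (.inl w : Place F) ≃ₗ[ℚ] Carrier (.inl w : Place F)}
    (h : φ ∈ ismDH logv (.inl w)) : Continuous φ ∧ Continuous φ.symm := by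
  rcases h with rfl | rfl
  · exact ⟨continuous_id, continuous_id⟩
  · exact ⟨continuous_neg, continuous_neg⟩

/-- **The realisation of an (Ind2) generator at a finite place** (Dupuy–Hilado §4.9): an element of
`ismDH` at `v` — a bicontinuous `ℚ`-linear automorphism of `K_v` with `φ(I_v) = I_v` — as an additive
homeomorphism of the carrier. [cite: DupuyHilado2025, §4.9] -/
def ismDHHomeoInr {v : HeightOneSpectrum (𝓞 F)}
    {φ : Carrier (.inr v : Place F) ≃ₗ[ℚ] Carrier (.inr v : Place F)}
    (h : φ ∈ ismDH logv (.inr v)) :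
    Carrier (.inr v : Place F) ≃ₜ+ Carrier (.inr v : Place F) :=
  homeoOfLinearEquiv φ h.1 h.2.1

/-- The realisation acts as `φ` does. [folklore] -/
@[simp] theorem coe_ismDHHomeoInr {v : HeightOneSpectrum (𝓞 F)}
    {φ : Carrier (.inr v : Place F) ≃ₗ[ℚ] Carrier (.inr v : Place F)}
    (h : φ ∈ ismDH logv (.inr v)) : ⇑(ismDHHomeoInr logv h) = ⇑φ := rfl

/-- The realisation maps the log-shell `I_v` onto itself (the defining clause of `ismDH`).
[cite: DupuyHilado2025, §4.9] -/
theorem ismDHHomeoInr_image_shell {v : HeightOneSpectrum (𝓞 F)}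
    {φ : Carrier (.inr v : Place F) ≃ₗ[ℚ] Carrier (.inr v : Place F)}
    (h : φ ∈ ismDH logv (.inr v)) :
    ismDHHomeoInr logv h '' shell logv (.inr v) = shell logv (.inr v) := h.2.2

/-- **The (Ind2) generator fixes the shell LATTICE**: `φ` maps the additive subgroup generated by the
log-shell — the integral structure `⟨I_v⟩` that the packet shells `shellPk` are built from
(`Thm311Real2.shellSubgroup`) — onto itself (abc-iut-c312-5's closure transport).
[cite: DupuyHilado2025, §4.9] -/
theorem ismDH_image_closure_shell {v : HeightOneSpectrum (𝓞 F)}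
    {φ : Carrier (.inr v : Place F) ≃ₗ[ℚ] Carrier (.inr v : Place F)}
    (h : φ ∈ ismDH logv (.inr v)) :
    φ '' (AddSubgroup.closure (shell logv (.inr v)) : Set (Carrier (.inr v : Place F))) =
      AddSubgroup.closure (shell logv (.inr v)) :=
  LogShells.image_closure_of_image_eq φ _ h.2.2

/-- For any `X : PilotData F`, the shell lattice of the DH instance IS that closure (definitional
bridge to `Thm311Real2.shellSubgroup`). [folklore] -/
theorem logShellsDH_shellSubgroup (X : PilotData F) (v : HeightOneSpectrum (𝓞 F)) :
    (logShellsDH X logv).shellSubgroup (.inr v) = AddSubgroup.closure (shell logv (.inr v)) := rfl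

/-- **DH §4.9's footnote at the real carrier**: an (Ind2) generator at a finite place preserves EVERY
normalised Haar measure of the carrier, as soon as the shell lattice is an integral structure (a compact
open subgroup — which it is for the analytic `p`-adic logarithm, abc-iut-S1 `LogShellTopology`; for a
degenerate binder `logv` no volume statement is claimed): "the measure of sets are preserved under these
maps". [cite: DupuyHilado2025, §4.9] -/
theorem haar_image_of_mem_ismDH {v : HeightOneSpectrum (𝓞 F)}
    [MeasurableSpace (Carrier (.inr v : Place F))] [BorelSpace (Carrier (.inr v : Place F))]
    {φ : Carrier (.inr v : Place F) ≃ₗ[ℚ] Carrier (.inr v : Place F)}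
    (h : φ ∈ ismDH logv (.inr v))
    (Λ₀ : IntegralStructure (Carrier (.inr v : Place F)))
    (hΛ₀ : (Λ₀ : Set (Carrier (.inr v : Place F))) =
      (AddSubgroup.closure (shell logv (.inr v)) : Set (Carrier (.inr v : Place F))))
    (Λ : IntegralStructure (Carrier (.inr v : Place F))) (A : Set (Carrier (.inr v : Place F))) :
    Λ.haar (φ '' A) = Λ.haar A := by
  have himg : ismDHHomeoInr logv h '' (Λ₀ : Set (Carrier (.inr v : Place F))) =
      (Λ₀ : Set (Carrier (.inr v : Place F))) := by
    rw [coe_ismDHHomeoInr, hΛ₀]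
    exact ismDH_image_closure_shell logv h
  have hres := Λ.haar_image_of_preserves (ismDHHomeoInr logv h) Λ₀ himg A
  rwa [coe_ismDHHomeoInr] at hres

end Real

end Thm311

end IUTFork

end Summit.ABC

end
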